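import Summits.QuantumFields.YangMills.Theorems.BalabanUVNodesN15TwoSpacingGluingNeumannKnitRightCube
import Summits.QuantumFields.YangMills.Theorems.BalabanUVNodesN15TwoSpacingGluingCovariantAdjoint
import HarnessLib

/-!
# THE GLUING STEP AT TWO LATTICE SPACINGS, LV: THE TWO-GRID η-DEFECT OF ONE CUBE's ADJOINT REMAINDER ROW — `𝔇((M_{χ′}G′(□))∘[Δ′_a, M_{h′}], (M_χG(□))∘[Δ_a, M_h])`, LOCAL PART
# PROVED FROM THE SANDWICHED RIGHT ENTRIES' DEFECTS, NONLOCAL PART DISPLAYED (dag-n15-c g13, FILE 97; N15 = NE2, s1 «background-layer OPERATOR ingredient»)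

Cell `pub-ymgap`, seat `pub-ymgap-dag-n15-c` (R134 (a); HUMAN RULING D-0062), generation 13.  `bears_on: R4∕N15 · K3⁸ SpineGivenEndpointR13SepCoPHV (stmt-QuantumFields-27366)`
(KEY MAP v2).  Filed `--supports stmt-QuantumFields-27366 --as helper` — COUNT-NEUTRAL.  Theorems only (0 `def`, 0 `sorry`).  Imports BY NAME FILE 94 `…NeumannKnitRightCube` and `…TwoSpacingGluingCovariantAdjoint` (`hasMaj_idef_comp_mulOp_loc`) (through them
FILES 45–91: `idef` calculus, `hasMaj_comp_diag`, `hasMaj_idef_mulOp`, FILE 49 `comp_commOp_lapOp`, FILE 64∕65 two-grid fits, FILE 67 letters, FILE 74 `coverFit_params`, FILE 94's bridges and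
supports, dag-n15-a N-IIn (a)±); nothing in the tree is modified.

WHY.  The last displayed row of FILE 96 `ne2PlusOperator_knit_of_rightDefect` is `𝔇(R̃′, R̃)`, the two-grid defect of the cover's adjoint remainder.  Per cube, `R̃`'s summand is
`M_h∘(M_χG(□))∘[Δ_a, M_h]` (FILE 94 `remainderL_cut`), and FILE 57 `hasMaj_idef_remainderL_out` reduces `𝔇(R̃′, R̃)` to the OUTPUT-localized defects of `(M_χG(□))∘[Δ_a, M_h]`.  By FILE 49's
expansion and dag-n15-a's sandwiches the local part `(M_χG(□))∘[Σ∇*∇, M_h]` is a sum of terms `T∘M_a` with `T ∈ {M_χG(□), T⁺_μ, T⁻_μ}` and `a` a first∕second difference of `h`; its defect is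
`𝔇(T′M_{a′}, TM_a) = T′𝔇(M_{a′}, M_a) + 𝔇(T′, T)M_a` — fine rows, two-grid fits of the partition's differences, and the two-sided defects `𝔇(M_{χ′}G′(□), M_χG(□))` (N-IIc), `𝔇(T′⁻, T⁻)`
(N-IIn (c)⁻), `𝔇(T′⁺, T⁺)` (N-IIo (c)⁺, conditional on the torus letter `hSrc`; N-IIr binder-free).

WHAT.  §1 ★★ `hasMaj_idef_comp_commOp_lapOp_of_sandwich` (one sandwiched term = my g11 `hasMaj_idef_comp_mulOp_loc` of `…TwoSpacingGluingCovariantAdjoint`, imported BY NAME) — the two-grid twin of FILE 94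
`hasMaj_comp_commOp_lapOp_of_sandwich`: `𝔇(G′∘[Σ∇′*∇′ + W′, M_{h′}], G∘[Σ∇*∇ + W, M_h]) ≤ 1_S1_S·(|J|(3(βo₂ + m₀c₂) + 2(β₁o₁ + m₁c₁)) + r_W)·e^{−δd}` (generic carrier).  §2 ★★★
**`hasMaj_idef_chiCube_neumannCubeG_comp_commOp_deltaOp`** — on `M_ν = 2qw`, cube `□_k` (side `qw`, margin `m₀ + 2w + 1 ≤ qw`, `3 ≤ L^k·w`), coarse spacing `L^{−k}`, fine `L^{−(k+r)}`
(King's pairing): from the fine torus letter of `G` (`C, δ₀`), fine two-sided rows of `T′^±_μ` (`β₁`), the two-sided defects `m_G` (cut cube), `m₁` (`T^±`), at ONE rate `δ₀`, and a DISPLAYED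
output-localized defect `r_N` of the nonlocal part `(M_χG(□))∘[aQ*Q − ∂Π∂*, M_h]` (rate `ρ ≤ δ₀`):
  `𝔇 ≤ 1_□(y)·((d+1)(3(βo₂ + m_Gc₂) + 2(β₁o₁ + m₁c₁)) + 0 + r_N)·e^{−ρd}`, `β = 2^{d+1}Ce^{δ₀}`, `c₁ = π∕w`, `c₂ = 32π²∕w²`, `o₁ = w⁻¹(L^kw)⁻¹(64 + (d+1))π²`, `o₂ = w⁻²(L^kw)⁻¹(144 + 32(d+1))π³`
— the shifted coefficients reduce to `∇h, ∇⁻h, ∇*∇h` by FILE 94's bridges, their fits are FILE 64∕65 `abs_fgrad∕bgrad∕fgradAdj_fgrad_hcube_two_grid_le` (FILE 74 `coverFit_params`, FILE 66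
`coverXi_shift`, FILE 67 `coverXi_offset`).  CONSUMER: the next file sums the cover and calls FILE 96.

HONEST FRAMING ∕ LIMITS.  Block-majorant bookkeeping over LANDED rows; the nonlocal part's defect (`r_N`) and (c)⁺'s defect (`m₁` for `T⁺`) are HYPOTHESES of §3 (dag-n15-a: WANT g13-2 (β);
N-IIr).  `U ≡ 1` doubled-cube torus MODEL (cube = half torus: circular as an estimate); nothing of [B5]∕[B6]∕[B9] asserted ([B9] Thm 3.14 = difference TEMPLATE).  NE2⁺ NOT PRINTED, NOT proved;
N15 NOT discharged; counts of record UNMOVED (typed 28∕28 · discharged 5∕27); one finite 𝕋⁴ at fixed ε per index — NOT infinite volume, NOT OS on ℝ⁴, NOT a mass gap, NOT Clay; R4 closes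
`BalabanLadder.UV` only.  Restate-immune (no Theses import).
-/

noncomputable section

namespace Summit.QuantumFields.YangMills.BalabanUVNodes.N15.Gluing

open Literature.MathematicalPhysics.QuantumFieldTheory.Balaban1983to89
open Literature.MathematicalPhysics.QuantumFieldTheory.Balaban1983to89.B5Prop11Plancherel (Tor fine unitVec)
open Literature.MathematicalPhysics.QuantumFieldTheory.Balaban1983to89.B11SectG (BlockNorm HasMaj hasMaj_zero)
open Literature.MathematicalPhysics.QuantumFieldTheory.Balaban1983to89.B6Prop26Gluing (mulOp ind ind_nonneg ind_le_one)
open Literature.MathematicalPhysics.QuantumFieldTheory.Balaban1983to89.T4EtaRateDefect (idef idef_comp idef_add idef_sub idef_zero)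
open Literature.MathematicalPhysics.QuantumFieldTheory.Balaban1983to89.T4EtaRateCoeffDefect (pull diagK hasMaj_mulOp hasMaj_idef_mulOp)
open Literature.MathematicalPhysics.QuantumFieldTheory.Balaban1983to89.B6UnitTorusCarrier (unitTorusGeo)
open Literature.MathematicalPhysics.QuantumFieldTheory.King1986.Torus (blockOf tdistT tdistT_nonneg)
open Summit.QuantumFields.YangMills.BalabanUVNodes.N15.VectorPiece (bshiftEquiv bshiftEquiv_apply bshiftEquiv_symm_apply kingPrV blkFine)
open Summit.QuantumFields.YangMills.BalabanUVNodes.N15.BackgroundLayer (fgrad fgradAdj bgrad fgrad_apply fgradAdj_apply bgrad_apply symbOp_sD_eq symbOp_sTinv_sub_one_eq)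
open Summit.QuantumFields.YangMills.BalabanUVNodes.N15.TwoGrid (paramsOf deltaOp gOp neumannCubeG symOp symbOp sD sTinv chiCube cubeBlocks landauRe qvRe qvAdjRe
  hasMaj_chiCube_symOp_comp hasMaj_comp_mulOp_chiInt chiCube_neumannCubeG_comp_sD_mulOp chiCube_neumannCubeG_comp_bgrad_mulOp)

variable {d : ℕ}

/-! ## §1 The adjoint (2.134) piece at two spacings (one sandwiched term = FILE 52 `hasMaj_idef_comp_mulOp_loc`) -/

section Piece

variable {X X' : Type} [Fintype X] [Fintype X'] {J : Type} [Fintype J] {g : B6.Geometry} (blk : X → g.Site) (π : X' → X)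

/-- ★★ **THE η-DEFECT OF THE ADJOINT (2.134) PIECE FROM SANDWICHED RIGHT ENTRIES** — the two-grid twin of FILE 94 `hasMaj_comp_commOp_lapOp_of_sandwich`.  Data at two spacings (primed =
fine): cube operators `G, G′`, sandwiches `G∘∇_μ∘M_{a⁺_μ} = T⁺_μ∘M_{a⁺_μ}`, `G∘∇⁻_μ∘M_{a⁻_μ} = T⁻_μ∘M_{a⁻_μ}` (both spacings; `a⁺ = (∇_μh)∘e_μ⁻¹`, `a⁻ = (∇⁻_μh)∘e_μ`), fine two-sided rows
`G′ ≤ 1_S1_Sβe^{−δd}`, `T′^± ≤ 1_S1_Sβ₁e^{−δd}`, two-sided defects `𝔇(G′,G) ≤ 1_S1_Sm₀e^{−δd}`, `𝔇(T′^±_μ, T^±_μ) ≤ 1_S1_Sm₁e^{−δd}`, the COARSE partition letters `|(∇h)∘e⁻¹|, |(∇⁻h)∘e| ≤ c₁`,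
`|∇*∇h|, |(∇∇h)∘e⁻¹|, |∇⁻((∇⁻h)∘e)| ≤ c₂`, their two-grid fits `o₁`, `o₂`, and the `W`-part's defect `r_W`:
  `𝔇(G′∘[Δ′_a, M_{h′}], G∘[Δ_a, M_h]) ≤ 1_S1_S·(|J|(3(βo₂ + m₀c₂) + 2(β₁o₁ + m₁c₁)) + r_W)·e^{−δd}`.
[cite: Balaban1984PropagatorsII, (2.133)–(2.134) p.247 (shapes, transposed); Balaban1985BackgroundPropagators, Thm 3.14 pp.426–427 (difference template)] -/
theorem hasMaj_idef_comp_commOp_lapOp_of_sandwich {n n' : ℝ} {e : J → X ≃ X} {e' : J → X' ≃ X'} {W G : (X → ℝ) →ₗ[ℝ] (X → ℝ)} {W' G' : (X' → ℝ) →ₗ[ℝ] (X' → ℝ)}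
    {TD TB : J → (X → ℝ) →ₗ[ℝ] (X → ℝ)} {TD' TB' : J → (X' → ℝ) →ₗ[ℝ] (X' → ℝ)} {h : X → ℝ} {h' : X' → ℝ} {S : Set g.Site} {β β₁ c₁ c₂ o₁ o₂ m₀ m₁ rW δ : ℝ}
    (hβ : 0 ≤ β) (hβ₁ : 0 ≤ β₁) (hc₁ : 0 ≤ c₁) (hc₂ : 0 ≤ c₂) (ho₁ : 0 ≤ o₁) (ho₂ : 0 ≤ o₂) (hm₀ : 0 ≤ m₀) (hm₁ : 0 ≤ m₁)
    -- coarse partition letters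
    (hhD : ∀ μ x, |(fgrad n (e μ) h ∘ ⇑(e μ).symm) x| ≤ c₁) (hhB : ∀ μ x, |(bgrad n (e μ) h ∘ ⇑(e μ)) x| ≤ c₁) (hh2 : ∀ μ x, |fgradAdj n (e μ) (fgrad n (e μ) h) x| ≤ c₂)
    (hh2f : ∀ μ x, |(fgrad n (e μ) (fgrad n (e μ) h) ∘ ⇑(e μ).symm) x| ≤ c₂) (hh2b : ∀ μ x, |bgrad n (e μ) (bgrad n (e μ) h ∘ ⇑(e μ)) x| ≤ c₂)
    -- two-grid fits of the five coefficients
    (hfD : ∀ μ x', |(fgrad n' (e' μ) h' ∘ ⇑(e' μ).symm) x' - (fgrad n (e μ) h ∘ ⇑(e μ).symm) (π x')| ≤ o₁)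
    (hfB : ∀ μ x', |(bgrad n' (e' μ) h' ∘ ⇑(e' μ)) x' - (bgrad n (e μ) h ∘ ⇑(e μ)) (π x')| ≤ o₁)
    (hf2 : ∀ μ x', |fgradAdj n' (e' μ) (fgrad n' (e' μ) h') x' - fgradAdj n (e μ) (fgrad n (e μ) h) (π x')| ≤ o₂)
    (hf2f : ∀ μ x', |(fgrad n' (e' μ) (fgrad n' (e' μ) h') ∘ ⇑(e' μ).symm) x' - (fgrad n (e μ) (fgrad n (e μ) h) ∘ ⇑(e μ).symm) (π x')| ≤ o₂)
    (hf2b : ∀ μ x', |bgrad n' (e' μ) (bgrad n' (e' μ) h' ∘ ⇑(e' μ)) x' - bgrad n (e μ) (bgrad n (e μ) h ∘ ⇑(e μ)) (π x')| ≤ o₂)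
    -- the sandwich identities at both spacings
    (hsD : ∀ μ, G ∘ₗ fgrad n (e μ) ∘ₗ mulOp (fgrad n (e μ) h ∘ ⇑(e μ).symm) = TD μ ∘ₗ mulOp (fgrad n (e μ) h ∘ ⇑(e μ).symm))
    (hsB : ∀ μ, G ∘ₗ bgrad n (e μ) ∘ₗ mulOp (bgrad n (e μ) h ∘ ⇑(e μ)) = TB μ ∘ₗ mulOp (bgrad n (e μ) h ∘ ⇑(e μ)))
    (hsD' : ∀ μ, G' ∘ₗ fgrad n' (e' μ) ∘ₗ mulOp (fgrad n' (e' μ) h' ∘ ⇑(e' μ).symm) = TD' μ ∘ₗ mulOp (fgrad n' (e' μ) h' ∘ ⇑(e' μ).symm))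
    (hsB' : ∀ μ, G' ∘ₗ bgrad n' (e' μ) ∘ₗ mulOp (bgrad n' (e' μ) h' ∘ ⇑(e' μ)) = TB' μ ∘ₗ mulOp (bgrad n' (e' μ) h' ∘ ⇑(e' μ)))
    -- fine two-sided rows and two-sided defects
    (hG' : HasMaj (BlockNorm.ofBlocks g (blk ∘ π)) (BlockNorm.ofBlocks g (blk ∘ π)) G' (fun y y' => ind S y * ind S y' * (β * Real.exp (-(δ * g.dist y y')))))
    (hTD' : ∀ μ, HasMaj (BlockNorm.ofBlocks g (blk ∘ π)) (BlockNorm.ofBlocks g (blk ∘ π)) (TD' μ) (fun y y' => ind S y * ind S y' * (β₁ * Real.exp (-(δ * g.dist y y')))))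
    (hTB' : ∀ μ, HasMaj (BlockNorm.ofBlocks g (blk ∘ π)) (BlockNorm.ofBlocks g (blk ∘ π)) (TB' μ) (fun y y' => ind S y * ind S y' * (β₁ * Real.exp (-(δ * g.dist y y')))))
    (hIG : HasMaj (BlockNorm.ofBlocks g blk) (BlockNorm.ofBlocks g (blk ∘ π)) (idef (pull π) (pull π) G' G) (fun y y' => ind S y * ind S y' * (m₀ * Real.exp (-(δ * g.dist y y')))))
    (hITD : ∀ μ, HasMaj (BlockNorm.ofBlocks g blk) (BlockNorm.ofBlocks g (blk ∘ π)) (idef (pull π) (pull π) (TD' μ) (TD μ))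
      (fun y y' => ind S y * ind S y' * (m₁ * Real.exp (-(δ * g.dist y y')))))
    (hITB : ∀ μ, HasMaj (BlockNorm.ofBlocks g blk) (BlockNorm.ofBlocks g (blk ∘ π)) (idef (pull π) (pull π) (TB' μ) (TB μ))
      (fun y y' => ind S y * ind S y' * (m₁ * Real.exp (-(δ * g.dist y y')))))
    (hDW : HasMaj (BlockNorm.ofBlocks g blk) (BlockNorm.ofBlocks g (blk ∘ π)) (idef (pull π) (pull π) (G' ∘ₗ commOp W' h') (G ∘ₗ commOp W h))
      (fun y y' => ind S y * ind S y' * (rW * Real.exp (-(δ * g.dist y y'))))) :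
    HasMaj (BlockNorm.ofBlocks g blk) (BlockNorm.ofBlocks g (blk ∘ π)) (idef (pull π) (pull π) (G' ∘ₗ commOp (lapOp n' e' W') h') (G ∘ₗ commOp (lapOp n e W) h))
      (fun y y' => ind S y * ind S y' * ((Fintype.card J * (3 * (β * o₂ + m₀ * c₂) + 2 * (β₁ * o₁ + m₁ * c₁)) + rW) * Real.exp (-(δ * g.dist y y')))) := by
  have hterm : ∀ μ, HasMaj (BlockNorm.ofBlocks g blk) (BlockNorm.ofBlocks g (blk ∘ π))
      (idef (pull π) (pull π)
        (G' ∘ₗ mulOp (fgradAdj n' (e' μ) (fgrad n' (e' μ) h')) -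
          ((G' ∘ₗ fgrad n' (e' μ)) ∘ₗ mulOp (fgrad n' (e' μ) h' ∘ ⇑(e' μ).symm) - G' ∘ₗ mulOp (fgrad n' (e' μ) (fgrad n' (e' μ) h') ∘ ⇑(e' μ).symm)) -
          ((G' ∘ₗ bgrad n' (e' μ)) ∘ₗ mulOp (bgrad n' (e' μ) h' ∘ ⇑(e' μ)) - G' ∘ₗ mulOp (bgrad n' (e' μ) (bgrad n' (e' μ) h' ∘ ⇑(e' μ)))))
        (G ∘ₗ mulOp (fgradAdj n (e μ) (fgrad n (e μ) h)) -
          ((G ∘ₗ fgrad n (e μ)) ∘ₗ mulOp (fgrad n (e μ) h ∘ ⇑(e μ).symm) - G ∘ₗ mulOp (fgrad n (e μ) (fgrad n (e μ) h) ∘ ⇑(e μ).symm)) -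
          ((G ∘ₗ bgrad n (e μ)) ∘ₗ mulOp (bgrad n (e μ) h ∘ ⇑(e μ)) - G ∘ₗ mulOp (bgrad n (e μ) (bgrad n (e μ) h ∘ ⇑(e μ))))))
      (fun y y' => ind S y * ind S y' * ((3 * (β * o₂ + m₀ * c₂) + 2 * (β₁ * o₁ + m₁ * c₁)) * Real.exp (-(δ * g.dist y y')))) := fun μ => by
    have t0 := hasMaj_idef_comp_mulOp_loc blk π hβ hm₀ hc₂ ho₂ (hh2 μ) (hf2 μ) hG' hIG
    have t1 : HasMaj (BlockNorm.ofBlocks g blk) (BlockNorm.ofBlocks g (blk ∘ π))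
        (idef (pull π) (pull π) ((G' ∘ₗ fgrad n' (e' μ)) ∘ₗ mulOp (fgrad n' (e' μ) h' ∘ ⇑(e' μ).symm)) ((G ∘ₗ fgrad n (e μ)) ∘ₗ mulOp (fgrad n (e μ) h ∘ ⇑(e μ).symm)))
        (fun y y' => ind S y * ind S y' * ((β₁ * o₁ + m₁ * c₁) * Real.exp (-(δ * g.dist y y')))) := by
      rw [LinearMap.comp_assoc, hsD' μ, LinearMap.comp_assoc, hsD μ]
      exact hasMaj_idef_comp_mulOp_loc blk π hβ₁ hm₁ hc₁ ho₁ (hhD μ) (hfD μ) (hTD' μ) (hITD μ)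
    have t2 := hasMaj_idef_comp_mulOp_loc blk π hβ hm₀ hc₂ ho₂ (hh2f μ) (hf2f μ) hG' hIG
    have t3 : HasMaj (BlockNorm.ofBlocks g blk) (BlockNorm.ofBlocks g (blk ∘ π))
        (idef (pull π) (pull π) ((G' ∘ₗ bgrad n' (e' μ)) ∘ₗ mulOp (bgrad n' (e' μ) h' ∘ ⇑(e' μ))) ((G ∘ₗ bgrad n (e μ)) ∘ₗ mulOp (bgrad n (e μ) h ∘ ⇑(e μ))))
        (fun y y' => ind S y * ind S y' * ((β₁ * o₁ + m₁ * c₁) * Real.exp (-(δ * g.dist y y')))) := by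
      rw [LinearMap.comp_assoc, hsB' μ, LinearMap.comp_assoc, hsB μ]
      exact hasMaj_idef_comp_mulOp_loc blk π hβ₁ hm₁ hc₁ ho₁ (hhB μ) (hfB μ) (hTB' μ) (hITB μ)
    have t4 := hasMaj_idef_comp_mulOp_loc blk π hβ hm₀ hc₂ ho₂ (hh2b μ) (hf2b μ) hG' hIG
    simp only [idef_sub]
    refine ((t0.sub (t1.sub t2)).sub (t3.sub t4)).mono fun y y' => le_of_eq ?_
    ring
  have hsum := hasMaj_fsum (b₁ := BlockNorm.ofBlocks g blk) (b₃ := BlockNorm.ofBlocks g (blk ∘ π)) Finset.univ _ _ fun μ _ => hterm μ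
  rw [comp_commOp_lapOp, comp_commOp_lapOp, idef_add, idef_fsum]
  refine (hsum.add hDW).mono fun y y' => le_of_eq ?_
  simp only [Finset.sum_const, Finset.card_univ, nsmul_eq_mul]
  ring

end Piece

/-! ## §2 The two-grid defect of ONE cube's adjoint remainder row, the nonlocal part displayed -/

section Cube

open Real

variable {M : Fin (d + 1) → ℕ} [∀ μ, NeZero (M μ)] {L kk r w q m₀ : ℕ} [NeZero L]

/-- ★★★ **THE TWO-GRID η-DEFECT OF ONE CUBE's ADJOINT REMAINDER ROW, LOCAL PART PROVED, NONLOCAL PART DISPLAYED.**  On `M_ν = 2qw`, cube `□_k` (side `qw`, margin `m₀ + 2w + 1 ≤ qw`,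
`3 ≤ L^k·w`), coarse spacing `L^{−k}` (King's unit blocks), fine spacing `L^{−(k+r)}` (the pairing's blocks): from the fine torus letter of `G` (`C, δ₀`), fine two-sided rows of `T′^±_μ` (`β₁`), the
two-sided cut defect `𝔇(M_{χ′}G′(□), M_χG(□))` (`m_G`; dag-n15-a N-IIc), two-sided defects `𝔇(T′^±_μ, T^±_μ)` (`m₁`; N-IIn (c)⁻, N-IIo∕r (c)⁺), all at ONE rate `δ₀`, and a DISPLAYED output-localized
defect of the nonlocal part `𝔇((M_{χ′}G′(□))∘[N′_L, M_{h′}], (M_χG(□))∘[N_L, M_h]) ≤ 1_□(y)·r_N·e^{−ρd}` (`N_L = aQ*Q − ∂Π∂*`; `ρ ≤ δ₀`):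
  `𝔇((M_{χ′}G′(□))∘[Δ′_a, M_{h′}], (M_χG(□))∘[Δ_a, M_h]) ≤ 1_□(y)·((d+1)(3(βo₂ + m_Gc₂) + 2(β₁o₁ + m₁c₁)) + 0 + r_N)·e^{−ρd}`,
`β = 2^{d+1}Ce^{δ₀}`, `c₁ = π∕w`, `c₂ = 32π²∕w²`, `o₁ = w⁻¹(L^kw)⁻¹(64 + (d+1))π²`, `o₂ = w⁻²(L^kw)⁻¹(144 + 32(d+1))π³` — §1 fed with FILE 94's bridges∕supports at both spacings, FILE 67's
letters and FILE 64∕65's two-grid fits of `∇h`, `∇⁻h`, `∇*∇h` (the shifted coefficients reduce to these: `(∇h)∘e⁻¹ = ∇⁻h`, `(∇⁻h)∘e = ∇h`, `(∇∇h)∘e⁻¹ = ∇⁻(∇h) = −∇*∇h`).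
[cite: Balaban1984PropagatorsII, (2.133)–(2.135) p.247 (shapes, transposed); Balaban1985BackgroundPropagators, Thm 3.14 pp.426–427 (difference template); Balaban1984PropagatorsII, (2.36)
p.229 (partition letters)] -/
theorem hasMaj_idef_chiCube_neumannCubeG_comp_commOp_deltaOp (hM : ∀ ν, M ν = 2 * q * w) (hw : 0 < w) (hfit : m₀ + 2 * w + 1 ≤ q * w) (h3 : 3 ≤ L ^ kk * w)
    (k : Fin (d + 1) → ZMod (2 * q)) {a C δ₀ β₁ mG m₁ rN ρ : ℝ} (ha : 0 < a) (hC : 0 < C) (hδ₀ : 0 < δ₀) (hβ₁ : 0 ≤ β₁) (hmG : 0 ≤ mG) (hm₁ : 0 ≤ m₁) (hρδ : ρ ≤ δ₀)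
    (hG' : HasMaj (BlockNorm.ofBlocks (unitTorusGeo L kk M) (fun x : Tor (fine (L ^ r * L ^ kk) M) × Fin (d + 1) => blockOf (L ^ r * L ^ kk) M x.1))
      (BlockNorm.ofBlocks (unitTorusGeo L kk M) (fun x : Tor (fine (L ^ r * L ^ kk) M) × Fin (d + 1) => blockOf (L ^ r * L ^ kk) M x.1)) (gOp M (L ^ r * L ^ kk) a)
      (fun y y' => C * Real.exp (-(δ₀ * tdistT M y y'))))
    (hTD' : ∀ μ, HasMaj (BlockNorm.ofBlocks (unitTorusGeo L kk M) (fun x : Tor (fine (L ^ r * L ^ kk) M) × Fin (d + 1) => blockOf (L ^ r * L ^ kk) M x.1))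
      (BlockNorm.ofBlocks (unitTorusGeo L kk M) (fun x : Tor (fine (L ^ r * L ^ kk) M) × Fin (d + 1) => blockOf (L ^ r * L ^ kk) M x.1))
      (mulOp (chiCube M (L ^ r * L ^ kk) (coverCorner M w q m₀ k) (q * w)) ∘ₗ symOp M (L ^ r * L ^ kk) (coverCorner M w q m₀ k) ∘ₗ
        (gOp M (L ^ r * L ^ kk) a ∘ₗ fgrad ((L ^ r * L ^ kk : ℕ) : ℝ) (bshiftEquiv M (L ^ r * L ^ kk) μ)) ∘ₗ mulOp (chiCube M (L ^ r * L ^ kk) (coverCorner M w q m₀ k) (q * w)))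
      (fun y y' => ind ((cubeBlocks M (coverCorner M w q m₀ k) (q * w) : Finset _) : Set _) y * ind ((cubeBlocks M (coverCorner M w q m₀ k) (q * w) : Finset _) : Set _) y' *
        (β₁ * Real.exp (-(δ₀ * tdistT M y y')))))
    (hTB' : ∀ μ, HasMaj (BlockNorm.ofBlocks (unitTorusGeo L kk M) (fun x : Tor (fine (L ^ r * L ^ kk) M) × Fin (d + 1) => blockOf (L ^ r * L ^ kk) M x.1))
      (BlockNorm.ofBlocks (unitTorusGeo L kk M) (fun x : Tor (fine (L ^ r * L ^ kk) M) × Fin (d + 1) => blockOf (L ^ r * L ^ kk) M x.1))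
      (-(mulOp (chiCube M (L ^ r * L ^ kk) (coverCorner M w q m₀ k) (q * w)) ∘ₗ symOp M (L ^ r * L ^ kk) (coverCorner M w q m₀ k) ∘ₗ
        (gOp M (L ^ r * L ^ kk) a ∘ₗ fgradAdj ((L ^ r * L ^ kk : ℕ) : ℝ) (bshiftEquiv M (L ^ r * L ^ kk) μ)) ∘ₗ mulOp (chiCube M (L ^ r * L ^ kk) (coverCorner M w q m₀ k) (q * w))))
      (fun y y' => ind ((cubeBlocks M (coverCorner M w q m₀ k) (q * w) : Finset _) : Set _) y * ind ((cubeBlocks M (coverCorner M w q m₀ k) (q * w) : Finset _) : Set _) y' *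
        (β₁ * Real.exp (-(δ₀ * tdistT M y y')))))
    (hIG : HasMaj (BlockNorm.ofBlocks (unitTorusGeo L kk M) (fun b : Tor (fine (L ^ kk) M) × Fin (d + 1) => blockOf (L ^ kk) M b.1))
      (BlockNorm.ofBlocks (unitTorusGeo L kk M) (fun x : Tor (fine (L ^ r * L ^ kk) M) × Fin (d + 1) => blockOf (L ^ r * L ^ kk) M x.1))
      (idef (pull (kingPrV L kk r M)) (pull (kingPrV L kk r M))
        (mulOp (chiCube M (L ^ r * L ^ kk) (coverCorner M w q m₀ k) (q * w)) ∘ₗ neumannCubeG M (L ^ r * L ^ kk) (coverCorner M w q m₀ k) (q * w) a)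
        (mulOp (chiCube M (L ^ kk) (coverCorner M w q m₀ k) (q * w)) ∘ₗ neumannCubeG M (L ^ kk) (coverCorner M w q m₀ k) (q * w) a))
      (fun y y' => ind ((cubeBlocks M (coverCorner M w q m₀ k) (q * w) : Finset _) : Set _) y * ind ((cubeBlocks M (coverCorner M w q m₀ k) (q * w) : Finset _) : Set _) y' *
        (mG * Real.exp (-(δ₀ * tdistT M y y')))))
    (hITD : ∀ μ, HasMaj (BlockNorm.ofBlocks (unitTorusGeo L kk M) (fun b : Tor (fine (L ^ kk) M) × Fin (d + 1) => blockOf (L ^ kk) M b.1))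
      (BlockNorm.ofBlocks (unitTorusGeo L kk M) (fun x : Tor (fine (L ^ r * L ^ kk) M) × Fin (d + 1) => blockOf (L ^ r * L ^ kk) M x.1))
      (idef (pull (kingPrV L kk r M)) (pull (kingPrV L kk r M))
        (mulOp (chiCube M (L ^ r * L ^ kk) (coverCorner M w q m₀ k) (q * w)) ∘ₗ symOp M (L ^ r * L ^ kk) (coverCorner M w q m₀ k) ∘ₗ
          (gOp M (L ^ r * L ^ kk) a ∘ₗ fgrad ((L ^ r * L ^ kk : ℕ) : ℝ) (bshiftEquiv M (L ^ r * L ^ kk) μ)) ∘ₗ mulOp (chiCube M (L ^ r * L ^ kk) (coverCorner M w q m₀ k) (q * w)))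
        (mulOp (chiCube M (L ^ kk) (coverCorner M w q m₀ k) (q * w)) ∘ₗ symOp M (L ^ kk) (coverCorner M w q m₀ k) ∘ₗ
          (gOp M (L ^ kk) a ∘ₗ fgrad ((L ^ kk : ℕ) : ℝ) (bshiftEquiv M (L ^ kk) μ)) ∘ₗ mulOp (chiCube M (L ^ kk) (coverCorner M w q m₀ k) (q * w))))
      (fun y y' => ind ((cubeBlocks M (coverCorner M w q m₀ k) (q * w) : Finset _) : Set _) y * ind ((cubeBlocks M (coverCorner M w q m₀ k) (q * w) : Finset _) : Set _) y' *
        (m₁ * Real.exp (-(δ₀ * tdistT M y y')))))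
    (hITB : ∀ μ, HasMaj (BlockNorm.ofBlocks (unitTorusGeo L kk M) (fun b : Tor (fine (L ^ kk) M) × Fin (d + 1) => blockOf (L ^ kk) M b.1))
      (BlockNorm.ofBlocks (unitTorusGeo L kk M) (fun x : Tor (fine (L ^ r * L ^ kk) M) × Fin (d + 1) => blockOf (L ^ r * L ^ kk) M x.1))
      (idef (pull (kingPrV L kk r M)) (pull (kingPrV L kk r M))
        (-(mulOp (chiCube M (L ^ r * L ^ kk) (coverCorner M w q m₀ k) (q * w)) ∘ₗ symOp M (L ^ r * L ^ kk) (coverCorner M w q m₀ k) ∘ₗ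
          (gOp M (L ^ r * L ^ kk) a ∘ₗ fgradAdj ((L ^ r * L ^ kk : ℕ) : ℝ) (bshiftEquiv M (L ^ r * L ^ kk) μ)) ∘ₗ mulOp (chiCube M (L ^ r * L ^ kk) (coverCorner M w q m₀ k) (q * w))))
        (-(mulOp (chiCube M (L ^ kk) (coverCorner M w q m₀ k) (q * w)) ∘ₗ symOp M (L ^ kk) (coverCorner M w q m₀ k) ∘ₗ
          (gOp M (L ^ kk) a ∘ₗ fgradAdj ((L ^ kk : ℕ) : ℝ) (bshiftEquiv M (L ^ kk) μ)) ∘ₗ mulOp (chiCube M (L ^ kk) (coverCorner M w q m₀ k) (q * w)))))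
      (fun y y' => ind ((cubeBlocks M (coverCorner M w q m₀ k) (q * w) : Finset _) : Set _) y * ind ((cubeBlocks M (coverCorner M w q m₀ k) (q * w) : Finset _) : Set _) y' *
        (m₁ * Real.exp (-(δ₀ * tdistT M y y')))))
    (hDN : HasMaj (BlockNorm.ofBlocks (unitTorusGeo L kk M) (fun b : Tor (fine (L ^ kk) M) × Fin (d + 1) => blockOf (L ^ kk) M b.1))
      (BlockNorm.ofBlocks (unitTorusGeo L kk M) (fun x : Tor (fine (L ^ r * L ^ kk) M) × Fin (d + 1) => blockOf (L ^ r * L ^ kk) M x.1))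
      (idef (pull (kingPrV L kk r M)) (pull (kingPrV L kk r M))
        ((mulOp (chiCube M (L ^ r * L ^ kk) (coverCorner M w q m₀ k) (q * w)) ∘ₗ neumannCubeG M (L ^ r * L ^ kk) (coverCorner M w q m₀ k) (q * w) a) ∘ₗ
          commOp (a • (qvAdjRe M (L ^ r * L ^ kk) ∘ₗ qvRe M (L ^ r * L ^ kk)) + (-landauRe M (L ^ r * L ^ kk))) (hcube (2 * q) (coverXi M (L ^ r * L ^ kk) w) k))
        ((mulOp (chiCube M (L ^ kk) (coverCorner M w q m₀ k) (q * w)) ∘ₗ neumannCubeG M (L ^ kk) (coverCorner M w q m₀ k) (q * w) a) ∘ₗ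
          commOp (a • (qvAdjRe M (L ^ kk) ∘ₗ qvRe M (L ^ kk)) + (-landauRe M (L ^ kk))) (hcube (2 * q) (coverXi M (L ^ kk) w) k)))
      (fun y y' => ind ((cubeBlocks M (coverCorner M w q m₀ k) (q * w) : Finset _) : Set _) y * (rN * Real.exp (-(ρ * tdistT M y y'))))) :
    HasMaj (BlockNorm.ofBlocks (unitTorusGeo L kk M) (fun b : Tor (fine (L ^ kk) M) × Fin (d + 1) => blockOf (L ^ kk) M b.1))
      (BlockNorm.ofBlocks (unitTorusGeo L kk M) (fun x : Tor (fine (L ^ r * L ^ kk) M) × Fin (d + 1) => blockOf (L ^ r * L ^ kk) M x.1))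
      (idef (pull (kingPrV L kk r M)) (pull (kingPrV L kk r M))
        ((mulOp (chiCube M (L ^ r * L ^ kk) (coverCorner M w q m₀ k) (q * w)) ∘ₗ neumannCubeG M (L ^ r * L ^ kk) (coverCorner M w q m₀ k) (q * w) a) ∘ₗ
          commOp (deltaOp M (L ^ r * L ^ kk) a) (hcube (2 * q) (coverXi M (L ^ r * L ^ kk) w) k))
        ((mulOp (chiCube M (L ^ kk) (coverCorner M w q m₀ k) (q * w)) ∘ₗ neumannCubeG M (L ^ kk) (coverCorner M w q m₀ k) (q * w) a) ∘ₗ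
          commOp (deltaOp M (L ^ kk) a) (hcube (2 * q) (coverXi M (L ^ kk) w) k)))
      (fun y y' => ind ((cubeBlocks M (coverCorner M w q m₀ k) (q * w) : Finset _) : Set _) y *
        (((Fintype.card (Fin (d + 1)) : ℝ) * (3 * (2 ^ (d + 1) * (C * Real.exp δ₀) * (((w : ℝ))⁻¹ ^ 2 * (((L ^ kk : ℕ) : ℝ) * w)⁻¹ * (144 * π ^ 3 + 32 * π ^ 3 * Fintype.card (Fin (d + 1)))) +
              mG * (32 * π ^ 2 / (w : ℝ) ^ 2)) +
            2 * (β₁ * (|((w : ℝ))⁻¹| * (((L ^ kk : ℕ) : ℝ) * w)⁻¹ * (64 * π ^ 2 + π ^ 2 * Fintype.card (Fin (d + 1)))) + m₁ * (π / w))) + 0 + rN) *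
          Real.exp (-(ρ * tdistT M y y')))) := by
  have hn : 1 ≤ L ^ kk := Nat.one_le_pow _ _ (Nat.pos_of_ne_zero (NeZero.ne L))
  have hn' : 1 ≤ L ^ r * L ^ kk := Nat.one_le_iff_ne_zero.mpr (Nat.mul_ne_zero (pow_ne_zero r (NeZero.ne L)) (pow_ne_zero kk (NeZero.ne L)))
  have hL1 : 1 ≤ L := Nat.pos_of_ne_zero (NeZero.ne L)
  have hM' : ∀ ν, M ν = 2 * (q * w) := fun ν => by rw [hM ν, mul_assoc]
  have hwR : (0 : ℝ) < w := by exact_mod_cast hw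
  have hβ : (0 : ℝ) ≤ 2 ^ (d + 1) * (C * Real.exp δ₀) := by positivity
  have hc₁ : (0 : ℝ) ≤ π / w := by positivity
  have hc₂ : (0 : ℝ) ≤ 32 * π ^ 2 / (w : ℝ) ^ 2 := by positivity
  have ho₁ : (0 : ℝ) ≤ |((w : ℝ))⁻¹| * (((L ^ kk : ℕ) : ℝ) * w)⁻¹ * (64 * π ^ 2 + π ^ 2 * Fintype.card (Fin (d + 1))) := by positivity
  have ho₂ : (0 : ℝ) ≤ ((w : ℝ))⁻¹ ^ 2 * (((L ^ kk : ℕ) : ℝ) * w)⁻¹ * (144 * π ^ 3 + 32 * π ^ 3 * Fintype.card (Fin (d + 1))) := by positivity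
  -- the fine two-sided cut row (N-IIIb)
  have hGc' : HasMaj (BlockNorm.ofBlocks (unitTorusGeo L kk M) (fun x : Tor (fine (L ^ r * L ^ kk) M) × Fin (d + 1) => blockOf (L ^ r * L ^ kk) M x.1))
      (BlockNorm.ofBlocks (unitTorusGeo L kk M) (fun x : Tor (fine (L ^ r * L ^ kk) M) × Fin (d + 1) => blockOf (L ^ r * L ^ kk) M x.1))
      (mulOp (chiCube M (L ^ r * L ^ kk) (coverCorner M w q m₀ k) (q * w)) ∘ₗ neumannCubeG M (L ^ r * L ^ kk) (coverCorner M w q m₀ k) (q * w) a)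
      (fun y y' => ind ((cubeBlocks M (coverCorner M w q m₀ k) (q * w) : Finset _) : Set _) y * ind ((cubeBlocks M (coverCorner M w q m₀ k) (q * w) : Finset _) : Set _) y' *
        (2 ^ (d + 1) * (C * Real.exp δ₀) * Real.exp (-(δ₀ * tdistT M y y')))) :=
    hasMaj_chiCube_symOp_comp (L := L) (k := kk) (c := coverCorner M w q m₀ k) (S := q * w) hC.le hδ₀.le hM'
      (hasMaj_comp_mulOp_chiInt (c := coverCorner M w q m₀ k) (S := q * w) hC.le hG')
  -- the coarse partition letters in §2's shapes
  have hh2 := fun μ x => abs_fgradAdj_fgrad_coverH_le (n := L ^ kk) hM hw k μ x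
  have hhD : ∀ (μ : Fin (d + 1)) (x : Tor (fine (L ^ kk) M) × Fin (d + 1)),
      |(fgrad ((L ^ kk : ℕ) : ℝ) (bshiftEquiv M (L ^ kk) μ) (hcube (2 * q) (coverXi M (L ^ kk) w) k) ∘ ⇑(bshiftEquiv M (L ^ kk) μ).symm) x| ≤ π / w := fun μ x => by
    rw [fgrad_comp_symm_eq_bgrad]; exact abs_bgrad_coverH_le hM hw k μ x
  have hhB : ∀ (μ : Fin (d + 1)) (x : Tor (fine (L ^ kk) M) × Fin (d + 1)),
      |(bgrad ((L ^ kk : ℕ) : ℝ) (bshiftEquiv M (L ^ kk) μ) (hcube (2 * q) (coverXi M (L ^ kk) w) k) ∘ ⇑(bshiftEquiv M (L ^ kk) μ)) x| ≤ π / w := fun μ x => by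
    rw [bgrad_comp_eq_fgrad]; exact abs_fgrad_coverH_le hM hw k μ x
  have hh2f : ∀ (μ : Fin (d + 1)) (x : Tor (fine (L ^ kk) M) × Fin (d + 1)),
      |(fgrad ((L ^ kk : ℕ) : ℝ) (bshiftEquiv M (L ^ kk) μ) (fgrad ((L ^ kk : ℕ) : ℝ) (bshiftEquiv M (L ^ kk) μ) (hcube (2 * q) (coverXi M (L ^ kk) w) k)) ∘
        ⇑(bshiftEquiv M (L ^ kk) μ).symm) x| ≤ 32 * π ^ 2 / (w : ℝ) ^ 2 := fun μ x => by
    rw [Function.comp_apply, fgrad_fgrad_apply_eq, Equiv.apply_symm_apply, abs_neg]; exact hh2 μ x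
  have hh2b : ∀ (μ : Fin (d + 1)) (x : Tor (fine (L ^ kk) M) × Fin (d + 1)),
      |bgrad ((L ^ kk : ℕ) : ℝ) (bshiftEquiv M (L ^ kk) μ) (bgrad ((L ^ kk : ℕ) : ℝ) (bshiftEquiv M (L ^ kk) μ) (hcube (2 * q) (coverXi M (L ^ kk) w) k) ∘ ⇑(bshiftEquiv M (L ^ kk) μ)) x| ≤
        32 * π ^ 2 / (w : ℝ) ^ 2 := fun μ x => by
    rw [bgrad_comp_eq_fgrad, bgrad_fgrad_apply_eq, abs_neg]; exact hh2 μ x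
  -- the two-grid fits (FILES 64∕65 with FILE 74's plumbing)
  obtain ⟨hs0, hs13, hs1', hs1, hsL, hnκ, hnκ'⟩ := coverFit_params (L := L) (kk := kk) (r := r) (w := w) hL1 hw h3
  have hξ := fun μ ν b => coverXi_shift (n := L ^ kk) hM hw μ ν b
  have hξ' := fun μ ν b => coverXi_shift (n := L ^ r * L ^ kk) hM hw μ ν b
  have hoff := fun ν x' => coverXi_offset (M := M) (L := L) (kk := kk) (r := r) (w := w) (q := q) ν x'
  have hq : 0 < q := by
    rcases Nat.eq_zero_or_pos q with h | h
    · exfalso; have := NeZero.ne (M 0); rw [hM 0, h] at this; simp at this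
    · exact h
  have hK2 : 2 ≤ 2 * q := by omega
  have hLr : 1 ≤ L ^ r := Nat.one_le_pow _ _ hL1
  have hf1 := fun μ x' => abs_fgrad_hcube_two_grid_le (2 * q) (coverXi M (L ^ kk) w) (coverXi M (L ^ r * L ^ kk) w) (kingPrV L kk r M) (bshiftEquiv M (L ^ kk))
    (bshiftEquiv M (L ^ r * L ^ kk)) hK2 hLr hs0 hs1' hsL hnκ hnκ' hξ hξ' hoff k μ x'
  have hf1b := fun μ x' => abs_bgrad_hcube_two_grid_le (2 * q) (coverXi M (L ^ kk) w) (coverXi M (L ^ r * L ^ kk) w) (kingPrV L kk r M) (bshiftEquiv M (L ^ kk))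
    (bshiftEquiv M (L ^ r * L ^ kk)) hK2 hLr hs0 hs1' hsL hnκ hnκ' hξ hξ' hoff k μ x'
  have hf2 := fun μ x' => abs_fgradAdj_fgrad_hcube_two_grid_le (2 * q) (coverXi M (L ^ kk) w) (coverXi M (L ^ r * L ^ kk) w) (kingPrV L kk r M) (bshiftEquiv M (L ^ kk))
    (bshiftEquiv M (L ^ r * L ^ kk)) hK2 hLr hs0 hs13 hs1 hsL hnκ hnκ' hξ hξ' hoff k μ x'
  have hfD : ∀ (μ : Fin (d + 1)) (x' : Tor (fine (L ^ r * L ^ kk) M) × Fin (d + 1)),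
      |(fgrad ((L ^ r * L ^ kk : ℕ) : ℝ) (bshiftEquiv M (L ^ r * L ^ kk) μ) (hcube (2 * q) (coverXi M (L ^ r * L ^ kk) w) k) ∘ ⇑(bshiftEquiv M (L ^ r * L ^ kk) μ).symm) x' -
        (fgrad ((L ^ kk : ℕ) : ℝ) (bshiftEquiv M (L ^ kk) μ) (hcube (2 * q) (coverXi M (L ^ kk) w) k) ∘ ⇑(bshiftEquiv M (L ^ kk) μ).symm) (kingPrV L kk r M x')| ≤
        |((w : ℝ))⁻¹| * (((L ^ kk : ℕ) : ℝ) * w)⁻¹ * (64 * π ^ 2 + π ^ 2 * Fintype.card (Fin (d + 1))) := fun μ x' => by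
    rw [fgrad_comp_symm_eq_bgrad, fgrad_comp_symm_eq_bgrad]; exact hf1b μ x'
  have hfB : ∀ (μ : Fin (d + 1)) (x' : Tor (fine (L ^ r * L ^ kk) M) × Fin (d + 1)),
      |(bgrad ((L ^ r * L ^ kk : ℕ) : ℝ) (bshiftEquiv M (L ^ r * L ^ kk) μ) (hcube (2 * q) (coverXi M (L ^ r * L ^ kk) w) k) ∘ ⇑(bshiftEquiv M (L ^ r * L ^ kk) μ)) x' -
        (bgrad ((L ^ kk : ℕ) : ℝ) (bshiftEquiv M (L ^ kk) μ) (hcube (2 * q) (coverXi M (L ^ kk) w) k) ∘ ⇑(bshiftEquiv M (L ^ kk) μ)) (kingPrV L kk r M x')| ≤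
        |((w : ℝ))⁻¹| * (((L ^ kk : ℕ) : ℝ) * w)⁻¹ * (64 * π ^ 2 + π ^ 2 * Fintype.card (Fin (d + 1))) := fun μ x' => by
    rw [bgrad_comp_eq_fgrad, bgrad_comp_eq_fgrad]; exact hf1 μ x'
  have hf2f : ∀ (μ : Fin (d + 1)) (x' : Tor (fine (L ^ r * L ^ kk) M) × Fin (d + 1)),
      |(fgrad ((L ^ r * L ^ kk : ℕ) : ℝ) (bshiftEquiv M (L ^ r * L ^ kk) μ) (fgrad ((L ^ r * L ^ kk : ℕ) : ℝ) (bshiftEquiv M (L ^ r * L ^ kk) μ)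
          (hcube (2 * q) (coverXi M (L ^ r * L ^ kk) w) k)) ∘ ⇑(bshiftEquiv M (L ^ r * L ^ kk) μ).symm) x' -
        (fgrad ((L ^ kk : ℕ) : ℝ) (bshiftEquiv M (L ^ kk) μ) (fgrad ((L ^ kk : ℕ) : ℝ) (bshiftEquiv M (L ^ kk) μ) (hcube (2 * q) (coverXi M (L ^ kk) w) k)) ∘
          ⇑(bshiftEquiv M (L ^ kk) μ).symm) (kingPrV L kk r M x')| ≤
        ((w : ℝ))⁻¹ ^ 2 * (((L ^ kk : ℕ) : ℝ) * w)⁻¹ * (144 * π ^ 3 + 32 * π ^ 3 * Fintype.card (Fin (d + 1))) := fun μ x' => by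
    rw [Function.comp_apply, Function.comp_apply, fgrad_fgrad_apply_eq, fgrad_fgrad_apply_eq, Equiv.apply_symm_apply, Equiv.apply_symm_apply, ← abs_neg]
    convert hf2 μ x' using 2; ring
  have hf2b : ∀ (μ : Fin (d + 1)) (x' : Tor (fine (L ^ r * L ^ kk) M) × Fin (d + 1)),
      |bgrad ((L ^ r * L ^ kk : ℕ) : ℝ) (bshiftEquiv M (L ^ r * L ^ kk) μ) (bgrad ((L ^ r * L ^ kk : ℕ) : ℝ) (bshiftEquiv M (L ^ r * L ^ kk) μ)
          (hcube (2 * q) (coverXi M (L ^ r * L ^ kk) w) k) ∘ ⇑(bshiftEquiv M (L ^ r * L ^ kk) μ)) x' -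
        bgrad ((L ^ kk : ℕ) : ℝ) (bshiftEquiv M (L ^ kk) μ) (bgrad ((L ^ kk : ℕ) : ℝ) (bshiftEquiv M (L ^ kk) μ) (hcube (2 * q) (coverXi M (L ^ kk) w) k) ∘ ⇑(bshiftEquiv M (L ^ kk) μ))
          (kingPrV L kk r M x')| ≤ ((w : ℝ))⁻¹ ^ 2 * (((L ^ kk : ℕ) : ℝ) * w)⁻¹ * (144 * π ^ 3 + 32 * π ^ 3 * Fintype.card (Fin (d + 1))) := fun μ x' => by
    rw [bgrad_comp_eq_fgrad, bgrad_comp_eq_fgrad, bgrad_fgrad_apply_eq, bgrad_fgrad_apply_eq, ← abs_neg]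
    convert hf2 μ x' using 2; ring
  -- the sandwich identities at both spacings (N-IIn (a)±, FILE 94's supports)
  have hsD : ∀ μ : Fin (d + 1), (mulOp (chiCube M (L ^ kk) (coverCorner M w q m₀ k) (q * w)) ∘ₗ neumannCubeG M (L ^ kk) (coverCorner M w q m₀ k) (q * w) a) ∘ₗ
      fgrad ((L ^ kk : ℕ) : ℝ) (bshiftEquiv M (L ^ kk) μ) ∘ₗ mulOp (fgrad ((L ^ kk : ℕ) : ℝ) (bshiftEquiv M (L ^ kk) μ) (hcube (2 * q) (coverXi M (L ^ kk) w) k) ∘ ⇑(bshiftEquiv M (L ^ kk) μ).symm) =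
      (mulOp (chiCube M (L ^ kk) (coverCorner M w q m₀ k) (q * w)) ∘ₗ symOp M (L ^ kk) (coverCorner M w q m₀ k) ∘ₗ
        (gOp M (L ^ kk) a ∘ₗ fgrad ((L ^ kk : ℕ) : ℝ) (bshiftEquiv M (L ^ kk) μ)) ∘ₗ mulOp (chiCube M (L ^ kk) (coverCorner M w q m₀ k) (q * w))) ∘ₗ
        mulOp (fgrad ((L ^ kk : ℕ) : ℝ) (bshiftEquiv M (L ^ kk) μ) (hcube (2 * q) (coverXi M (L ^ kk) w) k) ∘ ⇑(bshiftEquiv M (L ^ kk) μ).symm) := fun μ => by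
    have h := chiCube_neumannCubeG_comp_sD_mulOp (c := coverCorner M w q m₀ k) (S := q * w) hM' hn ha μ (fun b hb => bgrad_coverH_support hM hw hfit μ k b hb)
    rw [symbOp_sD_eq] at h
    exact h
  have hsB : ∀ μ : Fin (d + 1), (mulOp (chiCube M (L ^ kk) (coverCorner M w q m₀ k) (q * w)) ∘ₗ neumannCubeG M (L ^ kk) (coverCorner M w q m₀ k) (q * w) a) ∘ₗ
      bgrad ((L ^ kk : ℕ) : ℝ) (bshiftEquiv M (L ^ kk) μ) ∘ₗ mulOp (bgrad ((L ^ kk : ℕ) : ℝ) (bshiftEquiv M (L ^ kk) μ) (hcube (2 * q) (coverXi M (L ^ kk) w) k) ∘ ⇑(bshiftEquiv M (L ^ kk) μ)) =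
      (-(mulOp (chiCube M (L ^ kk) (coverCorner M w q m₀ k) (q * w)) ∘ₗ symOp M (L ^ kk) (coverCorner M w q m₀ k) ∘ₗ
        (gOp M (L ^ kk) a ∘ₗ fgradAdj ((L ^ kk : ℕ) : ℝ) (bshiftEquiv M (L ^ kk) μ)) ∘ₗ mulOp (chiCube M (L ^ kk) (coverCorner M w q m₀ k) (q * w)))) ∘ₗ
        mulOp (bgrad ((L ^ kk : ℕ) : ℝ) (bshiftEquiv M (L ^ kk) μ) (hcube (2 * q) (coverXi M (L ^ kk) w) k) ∘ ⇑(bshiftEquiv M (L ^ kk) μ)) := fun μ => by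
    have h := chiCube_neumannCubeG_comp_bgrad_mulOp (c := coverCorner M w q m₀ k) (S := q * w) hM' hn ha μ (fun b hb => fgrad_coverH_support hM hw hfit μ k b hb)
    rw [symbOp_sTinv_sub_one_eq, ← LinearMap.neg_comp] at h
    exact h
  have hsD' : ∀ μ : Fin (d + 1), (mulOp (chiCube M (L ^ r * L ^ kk) (coverCorner M w q m₀ k) (q * w)) ∘ₗ neumannCubeG M (L ^ r * L ^ kk) (coverCorner M w q m₀ k) (q * w) a) ∘ₗ
      fgrad ((L ^ r * L ^ kk : ℕ) : ℝ) (bshiftEquiv M (L ^ r * L ^ kk) μ) ∘ₗ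
        mulOp (fgrad ((L ^ r * L ^ kk : ℕ) : ℝ) (bshiftEquiv M (L ^ r * L ^ kk) μ) (hcube (2 * q) (coverXi M (L ^ r * L ^ kk) w) k) ∘ ⇑(bshiftEquiv M (L ^ r * L ^ kk) μ).symm) =
      (mulOp (chiCube M (L ^ r * L ^ kk) (coverCorner M w q m₀ k) (q * w)) ∘ₗ symOp M (L ^ r * L ^ kk) (coverCorner M w q m₀ k) ∘ₗ
        (gOp M (L ^ r * L ^ kk) a ∘ₗ fgrad ((L ^ r * L ^ kk : ℕ) : ℝ) (bshiftEquiv M (L ^ r * L ^ kk) μ)) ∘ₗ mulOp (chiCube M (L ^ r * L ^ kk) (coverCorner M w q m₀ k) (q * w))) ∘ₗ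
        mulOp (fgrad ((L ^ r * L ^ kk : ℕ) : ℝ) (bshiftEquiv M (L ^ r * L ^ kk) μ) (hcube (2 * q) (coverXi M (L ^ r * L ^ kk) w) k) ∘ ⇑(bshiftEquiv M (L ^ r * L ^ kk) μ).symm) :=
    fun μ => by
    have h := chiCube_neumannCubeG_comp_sD_mulOp (c := coverCorner M w q m₀ k) (S := q * w) hM' hn' ha μ (fun b hb => bgrad_coverH_support hM hw hfit μ k b hb)
    rw [symbOp_sD_eq] at h
    exact h
  have hsB' : ∀ μ : Fin (d + 1), (mulOp (chiCube M (L ^ r * L ^ kk) (coverCorner M w q m₀ k) (q * w)) ∘ₗ neumannCubeG M (L ^ r * L ^ kk) (coverCorner M w q m₀ k) (q * w) a) ∘ₗ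
      bgrad ((L ^ r * L ^ kk : ℕ) : ℝ) (bshiftEquiv M (L ^ r * L ^ kk) μ) ∘ₗ
        mulOp (bgrad ((L ^ r * L ^ kk : ℕ) : ℝ) (bshiftEquiv M (L ^ r * L ^ kk) μ) (hcube (2 * q) (coverXi M (L ^ r * L ^ kk) w) k) ∘ ⇑(bshiftEquiv M (L ^ r * L ^ kk) μ)) =
      (-(mulOp (chiCube M (L ^ r * L ^ kk) (coverCorner M w q m₀ k) (q * w)) ∘ₗ symOp M (L ^ r * L ^ kk) (coverCorner M w q m₀ k) ∘ₗ
        (gOp M (L ^ r * L ^ kk) a ∘ₗ fgradAdj ((L ^ r * L ^ kk : ℕ) : ℝ) (bshiftEquiv M (L ^ r * L ^ kk) μ)) ∘ₗ mulOp (chiCube M (L ^ r * L ^ kk) (coverCorner M w q m₀ k) (q * w)))) ∘ₗ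
        mulOp (bgrad ((L ^ r * L ^ kk : ℕ) : ℝ) (bshiftEquiv M (L ^ r * L ^ kk) μ) (hcube (2 * q) (coverXi M (L ^ r * L ^ kk) w) k) ∘ ⇑(bshiftEquiv M (L ^ r * L ^ kk) μ)) :=
    fun μ => by
    have h := chiCube_neumannCubeG_comp_bgrad_mulOp (c := coverCorner M w q m₀ k) (S := q * w) hM' hn' ha μ (fun b hb => fgrad_coverH_support hM hw hfit μ k b hb)
    rw [symbOp_sTinv_sub_one_eq, ← LinearMap.neg_comp] at h
    exact h
  -- the `W = 0` defect
  have hDW : HasMaj (BlockNorm.ofBlocks (unitTorusGeo L kk M) (fun b : Tor (fine (L ^ kk) M) × Fin (d + 1) => blockOf (L ^ kk) M b.1))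
      (BlockNorm.ofBlocks (unitTorusGeo L kk M) ((fun b : Tor (fine (L ^ kk) M) × Fin (d + 1) => blockOf (L ^ kk) M b.1) ∘ kingPrV L kk r M))
      (idef (pull (kingPrV L kk r M)) (pull (kingPrV L kk r M))
        ((mulOp (chiCube M (L ^ r * L ^ kk) (coverCorner M w q m₀ k) (q * w)) ∘ₗ neumannCubeG M (L ^ r * L ^ kk) (coverCorner M w q m₀ k) (q * w) a) ∘ₗ
          commOp (0 : (Tor (fine (L ^ r * L ^ kk) M) × Fin (d + 1) → ℝ) →ₗ[ℝ] (Tor (fine (L ^ r * L ^ kk) M) × Fin (d + 1) → ℝ)) (hcube (2 * q) (coverXi M (L ^ r * L ^ kk) w) k))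
        ((mulOp (chiCube M (L ^ kk) (coverCorner M w q m₀ k) (q * w)) ∘ₗ neumannCubeG M (L ^ kk) (coverCorner M w q m₀ k) (q * w) a) ∘ₗ
          commOp (0 : (Tor (fine (L ^ kk) M) × Fin (d + 1) → ℝ) →ₗ[ℝ] (Tor (fine (L ^ kk) M) × Fin (d + 1) → ℝ)) (hcube (2 * q) (coverXi M (L ^ kk) w) k)))
      (fun y y' => ind ((cubeBlocks M (coverCorner M w q m₀ k) (q * w) : Finset _) : Set _) y * ind ((cubeBlocks M (coverCorner M w q m₀ k) (q * w) : Finset _) : Set _) y' *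
        (0 * Real.exp (-(δ₀ * (unitTorusGeo L kk M).dist y y')))) := by
    rw [commOp_zero_left, commOp_zero_left, LinearMap.comp_zero, LinearMap.comp_zero, idef_zero]
    exact (hasMaj_zero _ _).mono fun y y' => le_of_eq (by ring)
  -- King's pairing of fine blocks
  have hblk : (fun x : Tor (fine (L ^ r * L ^ kk) M) × Fin (d + 1) => blockOf (L ^ r * L ^ kk) M x.1) =
      (fun b : Tor (fine (L ^ kk) M) × Fin (d + 1) => blockOf (L ^ kk) M b.1) ∘ kingPrV L kk r M := (VectorPiece.blkFine_comp_kingPrV (M := M) L kk r).symm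
  rw [hblk] at hGc' hTD' hTB' hIG hITD hITB hDN ⊢
  -- THE LOCAL PART (§1)
  have hloc := hasMaj_idef_comp_commOp_lapOp_of_sandwich (g := unitTorusGeo L kk M) (fun b : Tor (fine (L ^ kk) M) × Fin (d + 1) => blockOf (L ^ kk) M b.1) (kingPrV L kk r M)
    (S := ((cubeBlocks M (coverCorner M w q m₀ k) (q * w) : Finset _) : Set _)) hβ hβ₁ hc₁ hc₂ ho₁ ho₂ hmG hm₁ hhD hhB hh2 hh2f hh2b hfD hfB hf2 hf2f hf2b hsD hsB hsD' hsB'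
    hGc' hTD' hTB' hIG hITD hITB hDW
  -- THE SUM with the displayed nonlocal defect
  rw [deltaOp_eq_lapOp_zero_add, deltaOp_eq_lapOp_zero_add, commOp_add_left (lapOp _ _ _), commOp_add_left (lapOp _ _ _), LinearMap.comp_add, LinearMap.comp_add,
    idef_add]
  have hθ : (0 : ℝ) ≤ (Fintype.card (Fin (d + 1)) : ℝ) * (3 * (2 ^ (d + 1) * (C * Real.exp δ₀) * (((w : ℝ))⁻¹ ^ 2 * (((L ^ kk : ℕ) : ℝ) * w)⁻¹ * (144 * π ^ 3 + 32 * π ^ 3 * Fintype.card (Fin (d + 1)))) +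
        mG * (32 * π ^ 2 / (w : ℝ) ^ 2)) +
      2 * (β₁ * (|((w : ℝ))⁻¹| * (((L ^ kk : ℕ) : ℝ) * w)⁻¹ * (64 * π ^ 2 + π ^ 2 * Fintype.card (Fin (d + 1)))) + m₁ * (π / w))) + 0 := by positivity
  refine (hloc.add hDN).mono fun y y' => ?_
  have t1 := loc₂_le_loc₁ (L := L) (kk := kk) (S := ((cubeBlocks M (coverCorner M w q m₀ k) (q * w) : Finset _) : Set _)) hθ hρδ y y'
  refine (add_le_add t1 le_rfl).trans (le_of_eq ?_)
  simp only [unitTorusGeo, Fintype.card_fin]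
  ring

end Cube

end Summit.QuantumFields.YangMills.BalabanUVNodes.N15.Gluing

end
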